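import Mathlib
import Summits.MatrixMultiplication.MatrixMultiplication.Theses.LevelGradedCohnUmans
import Summits.MatrixMultiplication.MatrixMultiplication.Theses.SnSubsetDichotomy
import Literature.RepresentationTheory.FiniteGroups.VershikKerovMaxDegree

/-!
# Sketch — crux SnLevelDesigns (stmt-MatrixMultiplication-7613), crux-ideate round 1, ideator 1

First lemmas of the idea cards (signatures only; `sorry` in stubs is intentional).

* Card `classical-sandwich-gamma-scale`: `TokenSeparated`, `levelDim`, `GammaSubexp`,
  `BudgetPeeling`, `stub_gammaSubexp_implies_crux`, `stub_threshold_implies_crux`,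
  `neg_crux_implies_noThreshold`.
* Card `half-basis-affine-shadow`: `affinePerms`, `HalfBasisAffineDesigns`,
  `stub_halfBasis_implies_gammaSubexp`.
* Card `lis-bruhat-shield`: `tokenFeature`, `HasIncreasingSubseq`, `LisBasis`, `rankCount`, `BruhatLE`,
  `BruhatStraightening`, `ShieldSeparation`, `stub_shield`, `BruhatShieldDesigns`,
  `shieldDesigns_implies_gammaSubexp` (proved).
-/

noncomputable section

namespace Summit.MatrixMultiplication.MatrixMultiplication.Cruxes.SnLevelDesigns.Sketch

open Summit.MatrixMultiplication.MatrixMultiplication.Theses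
open Literature.NumberTheory.DiophantineGeometry (numStandardTableaux)

/-- `k`-token separation (the crux's first conjunct, verbatim, over an arbitrary finite point set `α`). -/
def TokenSeparated {α : Type*} [Fintype α] [DecidableEq α] (k : ℕ)
    (X Y Z : Finset (Equiv.Perm α)) : Prop :=
  ∀ x₀ ∈ X, ∀ z₀ ∈ Z, ∃ c : (Fin k → α) → (Fin k → α) → ℂ, ∀ x ∈ X, ∀ y ∈ Y, ∀ y' ∈ Y, ∀ z ∈ Z,
    (∑ p : Fin k → α, c p (⇑(x⁻¹ * y * y'⁻¹ * z) ∘ p)) = if x = x₀ ∧ y = y' ∧ z = z₀ then 1 else 0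

/-- The graded dimension `D_k(n) = Σ_{μ ⊢ n, μ₁ ≥ n-k} f_μ²` ( = dim J_k = #{π ∈ S_n : lis π ≥ n-k}
by Schensted), written with the crux's own sum at exponent `2`. -/
def levelDim (n k : ℕ) : ℝ :=
  ∑ μ : Nat.Partition n, if n - k ≤ μ.parts.sup then (numStandardTableaux μ : ℝ) ^ (2 : ℝ) else 0

/-- **C⁺ (ε-free form of the crux).** For every `c > 0` there are arbitrarily large levels `k`, some
`n ≥ k²` and a `k`-token-separated triple whose volume is within `e^{-c√k}` (per set) of the graded
wall `√D_k(n)`:  `e^{-c√k} · √D_k ≤ (|X||Y||Z|)^{1/3}`. -/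
def GammaSubexp : Prop :=
  ∀ c : ℝ, 0 < c → ∀ k₀ : ℕ, ∃ k ≥ k₀, ∃ n ≥ k ^ 2, ∃ X Y Z : Finset (Equiv.Perm (Fin n)),
    TokenSeparated k X Y Z ∧
      Real.exp (-(c * Real.sqrt k)) * Real.sqrt (levelDim n k) ≤
        ((X.card * Y.card * Z.card : ℕ) : ℝ) ^ ((1 : ℝ) / 3)

/-- **First-row peeling of the budget** (hook lengths in the first row of `(n-j,ν)` dominate those of
`(n-j)`): `f_{(n-j,ν)} ≤ C(n,j)·f_ν`, summed over the level-`k` shapes. Provable now. -/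
def BudgetPeeling : Prop :=
  ∀ (n k : ℕ) (s : ℝ), 0 ≤ s →
    (∑ μ : Nat.Partition n, if n - k ≤ μ.parts.sup then (numStandardTableaux μ : ℝ) ^ s else 0) ≤
      ∑ j ∈ Finset.range (k + 1),
        (n.choose j : ℝ) ^ s * ∑ ν : Nat.Partition j, (numStandardTableaux ν : ℝ) ^ s

/-- C⁺ ⟹ crux: bookkeeping from `BudgetPeeling`, the Vershik–Kerov upper bound
`f_max(S_k) ≤ √(k!)·e^{-c₂√k}` (tree theorem `VershikKerov1985_maxCharDegree_holds`) and
`D_k(n) ≥ c₀·C(n,k)²·k!` for `n ≥ k²`. -/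
theorem stub_gammaSubexp_implies_crux :
    GammaSubexp → LevelGradedCohnUmans.SnLevelDesigns := by
  sorry

/-- The classical threshold statement (route `SnSubsetDichotomy`, item 10882) implies the crux with
`k := n` (full level: every function is an `n`-token test, separation = TPP) and the VK upper bound. -/
theorem stub_threshold_implies_crux :
    SnSubsetDichotomy.ThresholdSubsetTriples → LevelGradedCohnUmans.SnLevelDesigns := by
  sorry

/-- Hence a refutation of the crux settles BCCGU17's subsets question negatively
(item 8302 `NoThresholdSubsetTriple`). -/
theorem neg_crux_implies_noThreshold
    (h : SnSubsetDichotomy.ThresholdSubsetTriples → LevelGradedCohnUmans.SnLevelDesigns) :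
    ¬ LevelGradedCohnUmans.SnLevelDesigns → SnSubsetDichotomy.NoThresholdSubsetTriple := by
  intro hneg
  have hT : ¬ SnSubsetDichotomy.ThresholdSubsetTriples := fun hT => hneg (h hT)
  unfold SnSubsetDichotomy.ThresholdSubsetTriples at hT
  unfold SnSubsetDichotomy.NoThresholdSubsetTriple
  push_neg at hT
  obtain ⟨c, hc, n₀, hn₀⟩ := hT
  exact ⟨c, hc, n₀, fun n hn S T U hTPP => hn₀ n hn S T U hTPP⟩

/-! ## Card `half-basis-affine-shadow` -/

/-- The affine group `AGL_d(𝔽₂)` as a set of permutations of `𝔽₂^d` (invertibility of `M` is automatic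
for a bijection). -/
def affinePerms (d : ℕ) : Set (Equiv.Perm (Fin d → ZMod 2)) :=
  {g | ∃ (M : Matrix (Fin d) (Fin d) (ZMod 2)) (v : Fin d → ZMod 2), ∀ x, g x = M.mulVec x + v}

/-- **Half-basis affine designs.** Inside ONE copy of `AGL_d(𝔽₂) < Sym(𝔽₂^d)` (so `n = 2^d`), at the
half-basis level `k = ⌈(d+1)/2⌉ = (d+2)/2`, `k`-token-separated triples within `e^{-c√k}` of the proxy
wall `C(n,k)·√(k!) ≥ √D_k(n)`. (Numerology: `|AGL_d(𝔽₂)|^{1/2} ≈ 0.54·C(n,k)·k!·… = n^k` exactly at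
this `k`.) -/
def HalfBasisAffineDesigns : Prop :=
  ∀ c : ℝ, 0 < c → ∀ d₀ : ℕ, ∃ d ≥ d₀, ∃ X Y Z : Finset (Equiv.Perm (Fin d → ZMod 2)),
    (↑X ⊆ affinePerms d ∧ ↑Y ⊆ affinePerms d ∧ ↑Z ⊆ affinePerms d) ∧
    TokenSeparated ((d + 2) / 2) X Y Z ∧
      Real.exp (-(c * Real.sqrt (((d + 2) / 2 : ℕ) : ℝ))) * ((2 ^ d).choose ((d + 2) / 2) : ℝ) *
          Real.sqrt ((((d + 2) / 2).factorial : ℕ) : ℝ) ≤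
        ((X.card * Y.card * Z.card : ℕ) : ℝ) ^ ((1 : ℝ) / 3)

/-- Transport along `(Fin d → ZMod 2) ≃ Fin (2^d)` and `C(n,k)√(k!) ≥ √D_k(n)`, `2^d ≥ ((d+2)/2)²`. -/
theorem stub_halfBasis_implies_gammaSubexp : HalfBasisAffineDesigns → GammaSubexp := by
  sorry

/-! ## Card `lis-bruhat-shield` -/

/-- The `k`-token feature of a permutation: which ordered `k`-tuple each `k`-tuple is sent to, as a
`0/1` vector indexed by pairs of tuples (a row of the "level-`k` Veronese map" `g ↦ ḡ ∈ A_k`). -/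
def tokenFeature {n : ℕ} (k : ℕ) (g : Equiv.Perm (Fin n)) : ((Fin k → Fin n) × (Fin k → Fin n)) → ℂ :=
  fun pq => if ⇑g ∘ pq.1 = pq.2 then 1 else 0

/-- Longest increasing subsequence length `≥ m`: some `m`-subset on which `g` is increasing. -/
def HasIncreasingSubseq {n : ℕ} (g : Equiv.Perm (Fin n)) (m : ℕ) : Prop :=
  ∃ S : Finset (Fin n), S.card = m ∧ ∀ i ∈ S, ∀ j ∈ S, i < j → g i < g j

/-- **LIS basis lemma (first checkable statement of the lifted-design line).** The permutations with an
increasing subsequence of length `≥ n-k` (there are `D_k(n)` of them, Schensted) have LINEARLY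
INDEPENDENT level-`k` features; since `dim J_k = D_k(n)` they form a basis of `A_k = ℂS_n/J_k^⊥`,
i.e. `L_k = {lis ≥ n-k}` is an interpolation set for `k`-token test functions. -/
def LisBasis : Prop :=
  ∀ (n k : ℕ), LinearIndependent ℂ
    (fun g : {g : Equiv.Perm (Fin n) // HasIncreasingSubseq g (n - k)} => tokenFeature k g.1)

theorem stub_lisBasis : LisBasis := by
  sorry

/-- Ehresmann/tableau rank counts `r_{ij}(g) = #{a ≤ i : g a ≥ j}`. -/
def rankCount {n : ℕ} (g : Equiv.Perm (Fin n)) (i j : Fin n) : ℕ :=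
  (Finset.univ.filter fun a : Fin n => a ≤ i ∧ j ≤ g a).card

/-- Bruhat(–Chevalley) order on `S_n` via the tableau criterion. -/
def BruhatLE {n : ℕ} (t g : Equiv.Perm (Fin n)) : Prop :=
  ∀ i j : Fin n, rankCount t i j ≤ rankCount g i j

/-- **Bruhat-triangular LIS straightening** (Raghavan–Samuel–Subrahmanyam 2012, eq. (5.1) with
§3.2.2 and Kazhdan–Lusztig 1979 Thm 1.1, at `λ = (n-k,1^k)`): the level-`k` feature of ANY `g` lies in
the span of the features of the `h ∈ L_k` that are Bruhat-below `g` (integer coefficients). Verified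
by machine for `(n,k) ∈ {(4,1),(4,2),(5,1),(5,2),(6,1),(6,2)}`. -/
def BruhatStraightening : Prop :=
  ∀ (n k : ℕ) (g : Equiv.Perm (Fin n)),
    tokenFeature k g ∈ Submodule.span ℂ (Set.range fun h :
      {h : Equiv.Perm (Fin n) // HasIncreasingSubseq h (n - k) ∧ BruhatLE h g} => tokenFeature k h.1)

/-- **Bruhat shield ⟹ separation.** Targets in `L_k`, pairwise distinct, and no non-target
Bruhat-above-or-equal to a target. -/
def ShieldSeparation : Prop :=
  ∀ (n k : ℕ) (X Y Z : Finset (Equiv.Perm (Fin n))),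
    (∀ x ∈ X, ∀ z ∈ Z, HasIncreasingSubseq (x⁻¹ * z) (n - k)) →
    (∀ x ∈ X, ∀ z ∈ Z, ∀ x' ∈ X, ∀ z' ∈ Z, x⁻¹ * z = x'⁻¹ * z' → x = x' ∧ z = z') →
    (∀ x ∈ X, ∀ z ∈ Z, ∀ x' ∈ X, ∀ y ∈ Y, ∀ y' ∈ Y, ∀ z' ∈ Z, y ≠ y' →
        ¬ BruhatLE (x⁻¹ * z) (x'⁻¹ * y * y'⁻¹ * z')) →
    TokenSeparated k X Y Z

theorem stub_shield : LisBasis → BruhatStraightening → ShieldSeparation := by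
  sorry

/-- **Design target of the line** (Bruhat-TPP triples near the graded wall). -/
def BruhatShieldDesigns : Prop :=
  ∀ c : ℝ, 0 < c → ∀ k₀ : ℕ, ∃ k ≥ k₀, ∃ n ≥ k ^ 2, ∃ X Y Z : Finset (Equiv.Perm (Fin n)),
    (∀ x ∈ X, ∀ z ∈ Z, HasIncreasingSubseq (x⁻¹ * z) (n - k)) ∧
    (∀ x ∈ X, ∀ z ∈ Z, ∀ x' ∈ X, ∀ z' ∈ Z, x⁻¹ * z = x'⁻¹ * z' → x = x' ∧ z = z') ∧
    (∀ x ∈ X, ∀ z ∈ Z, ∀ x' ∈ X, ∀ y ∈ Y, ∀ y' ∈ Y, ∀ z' ∈ Z, y ≠ y' →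
        ¬ BruhatLE (x⁻¹ * z) (x'⁻¹ * y * y'⁻¹ * z')) ∧
      Real.exp (-(c * Real.sqrt k)) * Real.sqrt (levelDim n k) ≤
        ((X.card * Y.card * Z.card : ℕ) : ℝ) ^ ((1 : ℝ) / 3)

theorem shieldDesigns_implies_gammaSubexp (hS : ShieldSeparation) :
    BruhatShieldDesigns → GammaSubexp := by
  intro h c hc k₀
  obtain ⟨k, hk, n, hn, X, Y, Z, h1, h2, h3, h4⟩ := h c hc k₀
  exact ⟨k, hk, n, hn, X, Y, Z, hS n k X Y Z h1 h2 h3, h4⟩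

end Summit.MatrixMultiplication.MatrixMultiplication.Cruxes.SnLevelDesigns.Sketch

end
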